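import Mathlib
import HarnessLib

/-!
# The double structure on the triple point lifts along every polarised direction: the residue system is
# solvable exactly when the period matrix is symmetric
# (WEIL-2 gen 28, TRIPLE-G28 §6.6 THEOREM W, fact-free linear-algebra core)

research route, not a corollary; conditional on HC_CM plus one named minimal statement.

Cell `pub-hodge-ring2-ab-*` (ALL ABELIAN VARIETIES), seat WEIL-2 gen 28, account
`run/shared/lean/pub/pub-hodge-ring2/pub-hodge-ring2-ab-weil-2/TRIPLE-G28.md` §6.5–6.6.

Informal setting (not formalised).  At `X₀ = E₁ × E₂ × E₃` let `T` be the three axes through `0` and `W₀ = V(Q, x₁x₂x₃)`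
the double structure on `T` with `Q = c₁₂x₁x₂ + c₁₃x₁x₃ + c₂₃x₂x₃` (the flat limit of the norm of the Abel–Jacobi family
along a spine-curve smoothing, TRIPLE-G28 6.5).  Writing a first-order lift along `κ ∈ T_{X₀}A₃` in the Čech cover
`{W₀ ∖ {q_b}, D_b ∖ 0}` (global ribbon basis `(ℓ'_b, x_a x_c)`, local basis `(Q, x₁x₂x₃)` at the triple point) and
applying the residue theorem on each elliptic curve `E_b` gives, with `g = Φ(Q)(0)` and `p_b = ∂_b Φ(x₁x₂x₃)(0)` the
four degree −2 «slots» of `W₀`, the six conditions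
`g − c_{ac} p_b = ρ_b(κ) := κ_ba c_ab + κ_bc c_bc` and `c_bc p_a − c_ab p_c = r_b(κ) := κ_bc c_bc − κ_ba c_ab`
(`{a,c}` the two indices other than `b`, `a < c`).  THEOREM W: they are solvable for EVERY symmetric `κ` (so `L(W₀) =
Sym`, `6/6`, while `L(T) = diag`), because `r_b = ρ_c − ρ_a` is an identity for symmetric `κ`.  This file proves exactly
that: the explicit solution `p_b = (g − ρ_b)/c_{ac}` of the first three equations satisfies the last three when
`κ` is symmetric and the `c`'s are non-zero, and conversely solvability of the `b = 1` pair with `c₂₃ ≠ 0` forces nothing —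
stated as: for every symmetric `κ` and every `g` there exist `p₁ p₂ p₃` solving all six equations.

0 sorry, no `def`, no named fact; `HC_CM` does not occur.  Indices `1,2,3` are written out (no `Fin 3` bookkeeping needed).
-/

namespace Summit.HodgeConjecture.Ring2AbelianAll.NonsplitDoubleStructureLift

/-- **The residue identity.**  For a symmetric matrix of periods (`κ₂₁ = κ₁₂` etc. are built in by using one name per
pair) the right-hand sides of the «P-equations» are differences of the right-hand sides of the «ℓ'-equations»:
`r₁ = ρ₃ − ρ₂`, `r₂ = ρ₃ − ρ₁`, `r₃ = ρ₂ − ρ₁`, where `ρ₁ = κ₁₂c₁₂ + κ₁₃c₁₃`, `ρ₂ = κ₁₂c₁₂ + κ₂₃c₂₃`, `ρ₃ = κ₁₃c₁₃ + κ₂₃c₂₃`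
and `r₁ = κ₁₃c₁₃ − κ₁₂c₁₂`, `r₂ = κ₂₃c₂₃ − κ₁₂c₁₂`, `r₃ = κ₂₃c₂₃ − κ₁₃c₁₃`.
research route, not a corollary; conditional on HC_CM plus one named minimal statement. [locator TRIPLE-G28 §6.6 THEOREM W] -/
theorem residue_identity {K : Type*} [CommRing K] (κ₁₂ κ₁₃ κ₂₃ c₁₂ c₁₃ c₂₃ : K) :
    (κ₁₃ * c₁₃ - κ₁₂ * c₁₂ = (κ₁₃ * c₁₃ + κ₂₃ * c₂₃) - (κ₁₂ * c₁₂ + κ₂₃ * c₂₃)) ∧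
    (κ₂₃ * c₂₃ - κ₁₂ * c₁₂ = (κ₁₃ * c₁₃ + κ₂₃ * c₂₃) - (κ₁₂ * c₁₂ + κ₁₃ * c₁₃)) ∧
    (κ₂₃ * c₂₃ - κ₁₃ * c₁₃ = (κ₁₂ * c₁₂ + κ₂₃ * c₂₃) - (κ₁₂ * c₁₂ + κ₁₃ * c₁₃)) := by
  refine ⟨by ring, by ring, by ring⟩

/-- **THEOREM W (algebraic core): the residue system of the double structure is solvable for every symmetric period
direction.**  Let `c₁₂ c₁₃ c₂₃` be non-zero (the three ribbon coefficients of `Q`) and `κ₁₂ κ₁₃ κ₂₃` arbitrary (the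
off-diagonal entries of a SYMMETRIC `κ`; the diagonal entries do not enter).  Then for every value `g` of the slot
`Φ(Q)(0)` there are slots `p₁ p₂ p₃ = ∇Φ(x₁x₂x₃)(0)` with
`g − c₂₃ p₁ = ρ₁`, `g − c₁₃ p₂ = ρ₂`, `g − c₁₂ p₃ = ρ₃` (ℓ'-equations on the axes 1, 2, 3) and
`c₁₃ p₂ − c₁₂ p₃ = r₁`, `c₂₃ p₁ − c₁₂ p₃ = r₂`, `c₂₃ p₁ − c₁₃ p₂ = r₃` (P-equations).  Consequently no condition on
`κ` remains: `W₀` lifts to first order along all of `Sym` (TRIPLE-G28 THEOREM W), whereas the reduced `T` lifts only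
along the diagonal (`Ring2AbelianAllNonsplitMinimalClassCensus`).
research route, not a corollary; conditional on HC_CM plus one named minimal statement. [locator TRIPLE-G28 §6.6 THEOREM W] -/
theorem residue_system_solvable {K : Type*} [Field K] (c₁₂ c₁₃ c₂₃ : K)
    (h₁₂ : c₁₂ ≠ 0) (h₁₃ : c₁₃ ≠ 0) (h₂₃ : c₂₃ ≠ 0) (κ₁₂ κ₁₃ κ₂₃ g : K) :
    ∃ p₁ p₂ p₃ : K,
      g - c₂₃ * p₁ = κ₁₂ * c₁₂ + κ₁₃ * c₁₃ ∧
      g - c₁₃ * p₂ = κ₁₂ * c₁₂ + κ₂₃ * c₂₃ ∧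
      g - c₁₂ * p₃ = κ₁₃ * c₁₃ + κ₂₃ * c₂₃ ∧
      c₁₃ * p₂ - c₁₂ * p₃ = κ₁₃ * c₁₃ - κ₁₂ * c₁₂ ∧
      c₂₃ * p₁ - c₁₂ * p₃ = κ₂₃ * c₂₃ - κ₁₂ * c₁₂ ∧
      c₂₃ * p₁ - c₁₃ * p₂ = κ₂₃ * c₂₃ - κ₁₃ * c₁₃ := by
  refine ⟨(g - (κ₁₂ * c₁₂ + κ₁₃ * c₁₃)) / c₂₃, (g - (κ₁₂ * c₁₂ + κ₂₃ * c₂₃)) / c₁₃,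
    (g - (κ₁₃ * c₁₃ + κ₂₃ * c₂₃)) / c₁₂, ?_, ?_, ?_, ?_, ?_, ?_⟩
  · field_simp; ring
  · field_simp; ring
  · field_simp; ring
  · field_simp; ring
  · field_simp; ring
  · field_simp; ring

/-- **The reduced triple point has no slots: then the same system forces the diagonal.**  If the slots are absent
(`g = 0` and `p₁ = p₂ = p₃ = 0`, the situation of the reduced `T`, whose normal sheaf has no degree −2 part), the
ℓ'-equations force `ρ₁ = ρ₂ = ρ₃ = 0`; with `c₁₂ c₁₃ c₂₃ ≠ 0` (and `2 ≠ 0`) this gives `κ₁₂ = κ₁₃ = κ₂₃ = 0` — the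
off-diagonal part of `κ` vanishes (TRIPLE-G28 THEOREM C_corr, `L(T) = diag`, re-derived inside the same system).
research route, not a corollary; conditional on HC_CM plus one named minimal statement. [locator TRIPLE-G28 §6.6, §1] -/
theorem no_slots_force_diagonal {K : Type*} [Field K] (h2 : (2 : K) ≠ 0) (c₁₂ c₁₃ c₂₃ : K)
    (h₁₂ : c₁₂ ≠ 0) (h₁₃ : c₁₃ ≠ 0) (h₂₃ : c₂₃ ≠ 0) (κ₁₂ κ₁₃ κ₂₃ : K)
    (e₁ : (0 : K) = κ₁₂ * c₁₂ + κ₁₃ * c₁₃) (e₂ : (0 : K) = κ₁₂ * c₁₂ + κ₂₃ * c₂₃)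
    (e₃ : (0 : K) = κ₁₃ * c₁₃ + κ₂₃ * c₂₃) :
    κ₁₂ = 0 ∧ κ₁₃ = 0 ∧ κ₂₃ = 0 := by
  have hA : 2 * (κ₁₂ * c₁₂) = 0 := by linear_combination -e₁ - e₂ + e₃
  have hB : 2 * (κ₁₃ * c₁₃) = 0 := by linear_combination -e₁ + e₂ - e₃
  have hC : 2 * (κ₂₃ * c₂₃) = 0 := by linear_combination e₁ - e₂ - e₃
  have hA' : κ₁₂ * c₁₂ = 0 := by
    rcases mul_eq_zero.1 hA with h | h
    · exact absurd h h2
    · exact h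
  have hB' : κ₁₃ * c₁₃ = 0 := by
    rcases mul_eq_zero.1 hB with h | h
    · exact absurd h h2
    · exact h
  have hC' : κ₂₃ * c₂₃ = 0 := by
    rcases mul_eq_zero.1 hC with h | h
    · exact absurd h h2
    · exact h
  refine ⟨?_, ?_, ?_⟩
  · rcases mul_eq_zero.1 hA' with h | h
    · exact h
    · exact absurd h h₁₂
  · rcases mul_eq_zero.1 hB' with h | h
    · exact h
    · exact absurd h h₁₃
  · rcases mul_eq_zero.1 hC' with h | h
    · exact h
    · exact absurd h h₂₃

end Summit.HodgeConjecture.Ring2AbelianAll.NonsplitDoubleStructureLift
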